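import Literature.MathematicalPhysics.QuantumLattice.HubbardThirdNeighbourHoppingInteraction
import Literature.MathematicalPhysics.QuantumLattice.TIGroundEnergyDensityResponse
import HarnessLib

/-!
# The `t–t'–t''` one-band interaction on `ℤ²` as a pencil in `t''`: mean-energy observable of the
# third-neighbour hopping, its norm, and concavity / Lipschitz continuity of the ground-state energy
# density in `t''`

Topic `Literature/MathematicalPhysics/QuantumLattice`. Companion of
`HubbardThirdNeighbourHoppingInteraction.lean` (`axialRange2HoppingFermionInteraction d t''`, the `t''` term of
the one-band cuprate dispersion of Pavarini et al., PRL 87 (2001) 047003, eq. (1)) and of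
`TIGroundEnergyDensityResponse.lean` (pencils `Ψ₀ + s·Ψ₁`, `tiGroundEnergyDensity`, concavity and
Lipschitz continuity along a pencil, Israel 1979 Thm. I.3.4):

* `axialRange2HoppingFermionInteraction_meanEnergyObs` — at range `2`,
  `E_Φ = Σ_i (½ Γ(Φ{0, 2e_i}) + ½ Γ(Φ{−2e_i, 0}))` in `𝔄_{[-2,2]^d}`; `norm_meanEnergyObs_axialRange2Hopping_le`
  — `‖E_Φ‖ ≤ 4 d |t''|` (Bratteli–Robinson I Prop. 2.3.11: `‖c‖, ‖c†‖ ≤ 1`).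
* `hubbardTT'T''FermionInteraction t t' t'' U` — THE `t–t'–t''` HUBBARD INTERACTION of the square lattice,
  DEFINED as the pencil `(hubbardTTPrimeFermionInteraction t t' U).pencil (axialRange2HoppingFermionInteraction 2 1) t''`;
  its terms are those of the `t–t'` interaction plus the `t''` bonds (`_apply`, the five cases), it is even
  and Hermitian, and at `t'' = 0` it IS the `t–t'` interaction (`_zero`).
* `concaveOn_tiGroundEnergyDensity_tpp` — `t'' ↦ e₀(t, t', t'', U)` (the translation-invariant ground-state
  energy density at any range parameter `R`) is concave on `ℝ`; `abs_tiGroundEnergyDensity_tpp_sub_le` —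
  it is `‖E_{Φ''(1)}‖_R`-Lipschitz; `abs_tiGroundEnergyDensity_tpp_sub_le_eight_mul` — at the natural range
  `R = 2`, `|e₀(t'') − e₀(s'')| ≤ 8 |t'' − s''|` (energy per site, same unit as the hoppings).

Written for the Hubbard material-oracle programme (cell `pub/hubbard-downfold`, seat hubbard-downfold-mod-1):
the one-band parameter box of a material carries `tpp/t` (object M = the Wannier Hamiltonian truncated at
printed range; object E = the `t–t'` refit); this file gives that coordinate a Hamiltonian referent in the
translation-invariant infinite-volume formalism in which stage S2 certifies words, so that two-anchor
transport in `t''` (chords floor, tangents cap — concavity) and the end-closing Lipschitz step are available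
by name. HONEST SCOPE: the Lipschitz constant `8` is the generic operator-norm one (the sharp kinematic
constant `16/π²` of the free dispersion is NOT claimed); nothing here is a torus-limit statement and nothing
bears on order / correlator words.

Everything is PROVED; the one definition is the pencil itself.

## References
* E. Pavarini, I. Dasgupta, T. Saha-Dasgupta, O. Jepsen, O. K. Andersen, Phys. Rev. Lett. 87 (2001)
  047003, eq. (1). [cite: PavariniEtAl2001, eq. (1)]
* R. B. Israel, *Convexity in the theory of lattice gases* (1979), Thm. I.3.4. [cite: Israel1979, Thm. I.3.4]
* O. Bratteli, D. W. Robinson, *Operator Algebras and Quantum Statistical Mechanics 1* (1987),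
  Prop. 2.3.11. [cite: BratteliRobinsonI1987, Prop. 2.3.11]
* O. Bratteli, A. Kishimoto, D. W. Robinson, Commun. Math. Phys. 64 (1978) 41, §3 (mean energy).
  [cite: BratteliKishimotoRobinson1978, §3]
-/

noncomputable section

namespace Literature.MathematicalPhysics.QuantumLattice

open Matrix Finset HubbardWave0 Literature.Probability.LatticeModels

variable {d : ℕ}

/-! ### The mean-energy observable of the axial range-2 hopping interaction -/

section MeanEnergy

variable (t'' : ℝ)

/-- **The mean-energy observable of the axial range-2 hopping interaction** (range `2`): in
`𝔄_{[-2,2]^d}`, `E_Φ = Σ_i (½ Γ(Φ{0, 2e_i}) + ½ Γ(Φ{-2e_i, 0}))`, one half of each of the `2d` axial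
range-2 bonds through the origin (every other `X ∋ 0` carries `Φ X = 0`).
[cite: BratteliKishimotoRobinson1978, §3 (mean energy functional)] -/
theorem axialRange2HoppingFermionInteraction_meanEnergyObs :
    (axialRange2HoppingFermionInteraction d t'').meanEnergyObs 2 =
      ∑ i : Fin d,
        ((2 : ℂ)⁻¹ • fermionEmbed (PolySite.incl (pair_axial2Vec_subset_thicken_two i))
            ((axialRange2HoppingFermionInteraction d t'').Φ {0, 0 + axial2Vec i}) +
          (2 : ℂ)⁻¹ • fermionEmbed (PolySite.incl (pair_neg_axial2Vec_subset_thicken_two i))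
            ((axialRange2HoppingFermionInteraction d t'').Φ {-axial2Vec i, -axial2Vec i + axial2Vec i})) := by
  classical
  set T : Finset (Site d) := thicken ({0} : Finset (Site d)) 2 with hT
  set F : Finset (Site d) → FermionOp T := fun X =>
    if h : X ⊆ T then ((X.card : ℂ)⁻¹) • fermionEmbed (PolySite.incl h) ((axialRange2HoppingFermionInteraction d t'').Φ X)
    else 0 with hF
  rw [FermionInteraction.meanEnergyObs_eq_sum]
  change ∑ X ∈ T.powerset with (0 : Site d) ∈ X, F X = _
  -- the support: `{0, 2e_i}`, `{-2e_i, 0}`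
  set S' : Finset (Finset (Site d)) :=
    (univ.image fun i : Fin d => ({0, 0 + axial2Vec i} : Finset (Site d))) ∪
      univ.image fun i : Fin d => ({-axial2Vec i, -axial2Vec i + axial2Vec i} : Finset (Site d)) with hS'
  have hS'sub : S' ⊆ T.powerset.filter fun X => (0 : Site d) ∈ X := by
    intro X hX
    rw [hS', mem_union, mem_image, mem_image] at hX
    rw [mem_filter, mem_powerset]
    rcases hX with ⟨i, -, rfl⟩ | ⟨i, -, rfl⟩
    · exact ⟨pair_axial2Vec_subset_thicken_two i, mem_insert_self _ _⟩
    · refine ⟨pair_neg_axial2Vec_subset_thicken_two i, ?_⟩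
      rw [neg_add_cancel]
      exact mem_insert_of_mem (mem_singleton_self _)
  have hzero : ∀ X ∈ T.powerset.filter (fun X => (0 : Site d) ∈ X), X ∉ S' → F X = 0 := by
    intro X hX hXS
    rw [mem_filter, mem_powerset] at hX
    have hΦ : (axialRange2HoppingFermionInteraction d t'').Φ X = 0 := by
      refine axialRange2HoppingFermionInteraction_apply_eq_zero t'' (fun x i hx => hXS ?_)
      have h0 := hX.2
      rw [hx, mem_insert, mem_singleton] at h0
      rw [hS', hx, mem_union, mem_image, mem_image]
      rcases h0 with h0 | h0
      · exact Or.inl ⟨i, mem_univ _, by rw [← h0, zero_add]⟩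
      · refine Or.inr ⟨i, mem_univ _, ?_⟩
        have : x = -axial2Vec i := eq_neg_of_add_eq_zero_left h0.symm
        rw [this]
    simp only [hF, hΦ, map_zero, smul_zero, dite_eq_ite, ite_self]
  rw [← Finset.sum_subset hS'sub hzero]
  -- split the sum over `S'`
  have hdisj : Disjoint (univ.image fun i : Fin d => ({0, 0 + axial2Vec i} : Finset (Site d)))
      (univ.image fun i : Fin d => ({-axial2Vec i, -axial2Vec i + axial2Vec i} : Finset (Site d))) := by
    rw [disjoint_iff_ne]
    rintro X hX Y hY rfl
    rw [mem_image] at hX hY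
    obtain ⟨i, -, rfl⟩ := hX
    obtain ⟨j, -, hj⟩ := hY
    have hmem : -axial2Vec j ∈ ({0, 0 + axial2Vec i} : Finset (Site d)) := hj ▸ mem_insert_self _ _
    rw [mem_insert, mem_singleton, zero_add, neg_eq_zero] at hmem
    rcases hmem with h | h
    · exact axial2Vec_ne_zero j h
    · exact axial2Vec_add_axial2Vec_ne_zero j i (show axial2Vec j + axial2Vec i = 0 by rw [← h, add_neg_cancel])
  have hinj1 : Set.InjOn (fun i : Fin d => ({0, 0 + axial2Vec i} : Finset (Site d))) ↑(univ : Finset (Fin d)) := by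
    intro i _ j _ h
    dsimp only at h
    have hmem : 0 + axial2Vec i ∈ ({0, 0 + axial2Vec j} : Finset (Site d)) :=
      h ▸ mem_insert_of_mem (mem_singleton_self _)
    rw [mem_insert, mem_singleton, zero_add, zero_add] at hmem
    rcases hmem with h' | h'
    · exact absurd h' (axial2Vec_ne_zero i)
    · exact axial2Vec_injective h'
  have hinj2 : Set.InjOn (fun i : Fin d => ({-axial2Vec i, -axial2Vec i + axial2Vec i} : Finset (Site d)))
      ↑(univ : Finset (Fin d)) := by
    intro i _ j _ h
    dsimp only at h
    have hmem : -axial2Vec i ∈ ({-axial2Vec j, -axial2Vec j + axial2Vec j} : Finset (Site d)) := by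
      have : -axial2Vec i ∈ ({-axial2Vec i, -axial2Vec i + axial2Vec i} : Finset (Site d)) := mem_insert_self _ _
      rwa [h] at this
    rw [mem_insert, mem_singleton, neg_add_cancel, neg_inj, neg_eq_zero] at hmem
    rcases hmem with h' | h'
    · exact axial2Vec_injective h'
    · exact absurd h' (axial2Vec_ne_zero i)
  rw [hS', Finset.sum_union hdisj, Finset.sum_image hinj1, Finset.sum_image hinj2, ← Finset.sum_add_distrib]
  -- evaluate `F` on the two kinds of sets
  have h1T : ∀ i : Fin d, ({0, 0 + axial2Vec i} : Finset (Site d)) ⊆ T := fun i =>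
    pair_axial2Vec_subset_thicken_two i
  have h2T : ∀ i : Fin d, ({-axial2Vec i, -axial2Vec i + axial2Vec i} : Finset (Site d)) ⊆ T := fun i =>
    pair_neg_axial2Vec_subset_thicken_two i
  have hF1 : ∀ i : Fin d, F {0, 0 + axial2Vec i} =
      (2 : ℂ)⁻¹ • fermionEmbed (PolySite.incl (h1T i)) ((axialRange2HoppingFermionInteraction d t'').Φ {0, 0 + axial2Vec i}) := by
    intro i
    simp only [hF]
    rw [dif_pos (h1T i), card_pair (self_ne_add_axial2Vec (0 : Site d) i), Nat.cast_ofNat]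
  have hF2 : ∀ i : Fin d, F {-axial2Vec i, -axial2Vec i + axial2Vec i} =
      (2 : ℂ)⁻¹ • fermionEmbed (PolySite.incl (h2T i))
        ((axialRange2HoppingFermionInteraction d t'').Φ {-axial2Vec i, -axial2Vec i + axial2Vec i}) := by
    intro i
    simp only [hF]
    rw [dif_pos (h2T i), card_pair (self_ne_add_axial2Vec (-axial2Vec i : Site d) i), Nat.cast_ofNat]
  exact Finset.sum_congr rfl fun i _ => by rw [hF1, hF2]

open scoped Matrix.Norms.L2Operator in
/-- An embedded axial range-2 bond term has norm `≤ 4|t''|` (`‖c‖, ‖c†‖ ≤ 1`, two spins, two terms).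
[cite: BratteliRobinsonI1987, Prop. 2.3.11] -/
theorem norm_fermionEmbed_axialRange2Hopping_pair_le {Λ' : Finset (Site d)} (x : Site d) (i : Fin d)
    (h : ({x, x + axial2Vec i} : Finset (Site d)) ⊆ Λ') :
    ‖fermionEmbed (PolySite.incl h) ((axialRange2HoppingFermionInteraction d t'').Φ {x, x + axial2Vec i})‖ ≤
      4 * |t''| := by
  rw [axialRange2HoppingFermionInteraction_apply_pair, fermionEmbed_smul, fermionEmbed_sum]
  simp only [fermionEmbed_add, fermionEmbed_mul, fermionEmbed_conjTranspose, fermionEmbed_incl_cAt]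
  exact norm_hoppingTerm_le t'' (fun σ => orb (PolySite.pt x (h (mem_insert_self _ _))) σ)
    (fun σ => orb (PolySite.pt (x + axial2Vec i) (h (mem_insert_of_mem (mem_singleton_self _)))) σ)

open scoped Matrix.Norms.L2Operator in
/-- **A-priori bound on the mean-energy observable**: `‖E_Φ‖ ≤ 4 d |t''|` (`2d` half-bonds of norm
`≤ 4|t''|` each). With `abs_tiGroundEnergyDensity_pencil_sub_le` this is the generic Lipschitz constant
of the ground-state energy density in `t''` (`8|Δt''|` per site on `ℤ²`; the sharp kinematic constant
`16/π²` is not claimed here). [cite: BratteliRobinsonI1987, Prop. 2.3.11] -/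
theorem norm_meanEnergyObs_axialRange2Hopping_le :
    ‖(axialRange2HoppingFermionInteraction d t'').meanEnergyObs 2‖ ≤ 4 * d * |t''| := by
  rw [axialRange2HoppingFermionInteraction_meanEnergyObs]
  have hhalf : ‖(2 : ℂ)⁻¹‖ = 2⁻¹ := by simp
  have hterm : ∀ i : Fin d,
      ‖(2 : ℂ)⁻¹ • fermionEmbed (PolySite.incl (pair_axial2Vec_subset_thicken_two i))
            ((axialRange2HoppingFermionInteraction d t'').Φ {0, 0 + axial2Vec i}) +
          (2 : ℂ)⁻¹ • fermionEmbed (PolySite.incl (pair_neg_axial2Vec_subset_thicken_two i))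
            ((axialRange2HoppingFermionInteraction d t'').Φ {-axial2Vec i, -axial2Vec i + axial2Vec i})‖ ≤
        4 * |t''| := by
    intro i
    refine (norm_add_le _ _).trans ?_
    rw [norm_smul, norm_smul, hhalf]
    have h1 := norm_fermionEmbed_axialRange2Hopping_pair_le t'' (0 : Site d) i (pair_axial2Vec_subset_thicken_two i)
    have h2 := norm_fermionEmbed_axialRange2Hopping_pair_le t'' (-axial2Vec i : Site d) i
      (pair_neg_axial2Vec_subset_thicken_two i)
    linarith
  calc _ ≤ ∑ i : Fin d, ‖(2 : ℂ)⁻¹ • fermionEmbed (PolySite.incl (pair_axial2Vec_subset_thicken_two i))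
            ((axialRange2HoppingFermionInteraction d t'').Φ {0, 0 + axial2Vec i}) +
          (2 : ℂ)⁻¹ • fermionEmbed (PolySite.incl (pair_neg_axial2Vec_subset_thicken_two i))
            ((axialRange2HoppingFermionInteraction d t'').Φ {-axial2Vec i, -axial2Vec i + axial2Vec i})‖ :=
        norm_sum_le _ _
    _ ≤ ∑ _i : Fin d, 4 * |t''| := Finset.sum_le_sum fun i _ => hterm i
    _ = 4 * d * |t''| := by rw [Finset.sum_const, Finset.card_univ, Fintype.card_fin, nsmul_eq_mul]; ring

end MeanEnergy

/-! ### The `t–t'–t''` interaction of the square lattice as a pencil in `t''` -/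

section TTPrimeTPP

/-- **The `t–t'–t''` Hubbard interaction on `ℤ²`**: nearest-neighbour hopping `t`, diagonal hopping
`t'`, axial range-2 hopping `t''`, on-site repulsion `U` — by DEFINITION the pencil
`Ψ^{t,t',U} + t'' · Φ''(1)` of the `t–t'` interaction and the unit-amplitude third-neighbour hopping
(so `Φ {x} = U n_{x↑}n_{x↓}`, `Φ {x, x+e_i} = −tΣ_σ(c†c + h.c.)`, `Φ {x, x+e₁±e₂} = −t'Σ_σ(…)`,
`Φ {x, x+2e_i} = −t''Σ_σ(…)`, `Φ X = 0` otherwise). The one-electron part is Pavarini et al. (2001)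
eq. (1) truncated after `t''`. [cite: PavariniEtAl2001, eq. (1)] -/
def hubbardTT'T''FermionInteraction (t t' t'' U : ℝ) : FermionInteraction 2 :=
  (hubbardTTPrimeFermionInteraction t t' U).pencil (axialRange2HoppingFermionInteraction 2 1) t''

variable (t t' t'' U : ℝ)

/-- The terms of the `t–t'–t''` interaction: `Φ X = Φ^{t,t',U} X + Φ''^{t''} X`.
[cite: PavariniEtAl2001, eq. (1)] -/
theorem hubbardTT'T''FermionInteraction_apply (X : Finset (Site 2)) :
    (hubbardTT'T''FermionInteraction t t' t'' U).Φ X =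
      (hubbardTTPrimeFermionInteraction t t' U).Φ X + (axialRange2HoppingFermionInteraction 2 t'').Φ X := by
  rw [hubbardTT'T''FermionInteraction, FermionInteraction.pencil_apply,
    ← axialRange2HoppingFermionInteraction_smul_apply, mul_one]

/-- **The `t–t'–t''` interaction is even.** [cite: ArakiMoriya2003, §1 assumption (II)] -/
theorem hubbardTT'T''FermionInteraction_isEven : (hubbardTT'T''FermionInteraction t t' t'' U).IsEven :=
  FermionInteraction.isEven_pencil (hubbardTTPrimeFermionInteraction_isEven t t' U)
    (axialRange2HoppingFermionInteraction_isEven 1) t''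

/-- **The `t–t'–t''` interaction is Hermitian** (real couplings). [cite: PavariniEtAl2001, eq. (1)] -/
theorem hubbardTT'T''FermionInteraction_isHermitian :
    (hubbardTT'T''FermionInteraction t t' t'' U).IsHermitian :=
  FermionInteraction.isHermitian_pencil (hubbardTTPrimeFermionInteraction_isHermitian t t' U)
    (axialRange2HoppingFermionInteraction_isHermitian 1) t''

/-- Two interactions with the same terms are equal. [folklore] -/
private theorem FermionInteraction.ext_of_apply {Ψ Ψ' : FermionInteraction d} (h : ∀ X, Ψ.Φ X = Ψ'.Φ X) : Ψ = Ψ' := by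
  cases Ψ; cases Ψ'
  exact congrArg FermionInteraction.mk (funext h)

/-- **At `t'' = 0` the `t–t'–t''` interaction is the `t–t'` interaction.** [cite: PavariniEtAl2001, eq. (1)] -/
theorem hubbardTT'T''FermionInteraction_zero :
    hubbardTT'T''FermionInteraction t t' 0 U = hubbardTTPrimeFermionInteraction t t' U :=
  FermionInteraction.ext_of_apply fun X => FermionInteraction.pencil_zero_apply _ _ X

/-- On-site term: `Φ {x} = U n_{x↑} n_{x↓}`. [cite: PavariniEtAl2001, eq. (1)] -/
theorem hubbardTT'T''FermionInteraction_apply_singleton (x : Site 2) :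
    (hubbardTT'T''FermionInteraction t t' t'' U).Φ {x} =
      (U : ℂ) • (nAt x (mem_singleton_self x) 0 * nAt x (mem_singleton_self x) 1) := by
  rw [hubbardTT'T''FermionInteraction_apply, hubbardTTPrimeFermionInteraction_apply_singleton,
    axialRange2HoppingFermionInteraction_apply_singleton, add_zero]

/-- Nearest-neighbour bond term (that of the Hubbard interaction). [cite: PavariniEtAl2001, eq. (1)] -/
theorem hubbardTT'T''FermionInteraction_apply_pair_unitVec (x : Site 2) (i : Fin 2) :
    (hubbardTT'T''FermionInteraction t t' t'' U).Φ {x, x + unitVec i} =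
      (hubbardFermionInteraction 2 t U).Φ {x, x + unitVec i} := by
  rw [hubbardTT'T''FermionInteraction_apply, hubbardTTPrimeFermionInteraction_apply_pair_unitVec,
    axialRange2HoppingFermionInteraction_apply_pair_unitVec, add_zero]

/-- Diagonal bond term (that of the diagonal hopping). [cite: PavariniEtAl2001, eq. (1)] -/
theorem hubbardTT'T''FermionInteraction_apply_pair_diagVec (x : Site 2) (s : Fin 2) :
    (hubbardTT'T''FermionInteraction t t' t'' U).Φ {x, x + diagVec s} =
      (diagHoppingFermionInteraction t').Φ {x, x + diagVec s} := by
  rw [hubbardTT'T''FermionInteraction_apply, hubbardTTPrimeFermionInteraction_apply_pair_diagVec,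
    axialRange2HoppingFermionInteraction_apply_pair_diagVec, add_zero]

/-- Axial range-2 bond term (that of the third-neighbour hopping). [cite: PavariniEtAl2001, eq. (1)] -/
theorem hubbardTT'T''FermionInteraction_apply_pair_axial2Vec (x : Site 2) (i : Fin 2) :
    (hubbardTT'T''FermionInteraction t t' t'' U).Φ {x, x + axial2Vec i} =
      (axialRange2HoppingFermionInteraction 2 t'').Φ {x, x + axial2Vec i} := by
  rw [hubbardTT'T''FermionInteraction_apply, hubbardTTPrimeFermionInteraction_apply,
    hubbardFermionInteraction_apply_pair_axial2Vec, diagHoppingFermionInteraction_apply_pair_axial2Vec,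
    zero_add, zero_add]

/-- All other terms vanish. [cite: PavariniEtAl2001, eq. (1)] -/
theorem hubbardTT'T''FermionInteraction_apply_eq_zero {X : Finset (Site 2)} (h1 : ∀ x : Site 2, X ≠ {x})
    (h2 : ∀ (x : Site 2) (i : Fin 2), X ≠ {x, x + unitVec i})
    (h3 : ∀ (x : Site 2) (s : Fin 2), X ≠ {x, x + diagVec s})
    (h4 : ∀ (x : Site 2) (i : Fin 2), X ≠ {x, x + axial2Vec i}) :
    (hubbardTT'T''FermionInteraction t t' t'' U).Φ X = 0 := by
  rw [hubbardTT'T''FermionInteraction_apply, hubbardTTPrimeFermionInteraction_apply_eq_zero t t' U h1 h2 h3,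
    axialRange2HoppingFermionInteraction_apply_eq_zero t'' h4, add_zero]

/-- The mean-energy observable splits: `E^{tt't''} = E^{tt'} + t'' · E^{Φ''(1)}`.
[cite: BratteliKishimotoRobinson1978, §3 (mean energy functional)] -/
theorem hubbardTT'T''FermionInteraction_meanEnergyObs (R : ℝ) :
    (hubbardTT'T''FermionInteraction t t' t'' U).meanEnergyObs R =
      (hubbardTTPrimeFermionInteraction t t' U).meanEnergyObs R +
        (t'' : ℂ) • (axialRange2HoppingFermionInteraction 2 1).meanEnergyObs R :=
  FermionInteraction.meanEnergyObs_pencil _ _ t'' R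

/-- The mean energy of a state is affine in `t''`: `e^{tt't''}(ω) = e^{tt'}(ω) + t'' · e^{Φ''(1)}(ω)` —
`e^{Φ''(1)}(ω)` is the third-neighbour bond (kinetic) density of `ω`.
[cite: BratteliKishimotoRobinson1978, §3 (mean energy functional)] -/
theorem InfVolFermionState.meanEnergy_hubbardTT'T'' (ω : InfVolFermionState 2) (R : ℝ) :
    ω.meanEnergy (hubbardTT'T''FermionInteraction t t' t'' U) R =
      ω.meanEnergy (hubbardTTPrimeFermionInteraction t t' U) R +
        t'' * ω.meanEnergy (axialRange2HoppingFermionInteraction 2 1) R :=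
  ω.meanEnergy_pencil _ _ t'' R

/-- **The ground-state energy density is concave in `t''`** (at any range parameter `R`): an infimum of
functions affine in `t''`. Israel (1979) Thm. I.3.4. [cite: Israel1979, Thm. I.3.4] -/
theorem concaveOn_tiGroundEnergyDensity_tpp (R : ℝ) :
    ConcaveOn ℝ Set.univ fun t'' : ℝ => (hubbardTT'T''FermionInteraction t t' t'' U).tiGroundEnergyDensity R :=
  FermionInteraction.concaveOn_tiGroundEnergyDensity_pencil _ _ R

open scoped Matrix.Norms.L2Operator in
/-- **Lipschitz continuity in `t''`** (at any range parameter `R`):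
`|e₀(t, t', t'', U) − e₀(t, t', s'', U)| ≤ ‖E_{Φ''(1)}‖_R · |t'' − s''|`. Israel (1979) Thm. I.3.4.
[cite: Israel1979, Thm. I.3.4] -/
theorem abs_tiGroundEnergyDensity_tpp_sub_le (R s'' : ℝ) :
    |(hubbardTT'T''FermionInteraction t t' t'' U).tiGroundEnergyDensity R -
        (hubbardTT'T''FermionInteraction t t' s'' U).tiGroundEnergyDensity R| ≤
      ‖(axialRange2HoppingFermionInteraction 2 1).meanEnergyObs R‖ * |t'' - s''| :=
  FermionInteraction.abs_tiGroundEnergyDensity_pencil_sub_le _ _ R t'' s''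

open scoped Matrix.Norms.L2Operator in
/-- **Lipschitz continuity in `t''` with the generic constant** (range parameter `2`, the range of the
interaction): `|e₀(t, t', t'', U) − e₀(t, t', s'', U)| ≤ 8 |t'' − s''|` (`‖E_{Φ''(1)}‖ ≤ 4·2·1`).
[cite: Israel1979, Thm. I.3.4] -/
theorem abs_tiGroundEnergyDensity_tpp_sub_le_eight_mul (s'' : ℝ) :
    |(hubbardTT'T''FermionInteraction t t' t'' U).tiGroundEnergyDensity 2 -
        (hubbardTT'T''FermionInteraction t t' s'' U).tiGroundEnergyDensity 2| ≤ 8 * |t'' - s''| := by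
  refine (abs_tiGroundEnergyDensity_tpp_sub_le t t' t'' U 2 s'').trans ?_
  have h := norm_meanEnergyObs_axialRange2Hopping_le (d := 2) (1 : ℝ)
  rw [abs_one, mul_one, Nat.cast_ofNat] at h
  have h8 : ‖(axialRange2HoppingFermionInteraction 2 1).meanEnergyObs 2‖ ≤ 8 := by
    linarith
  exact mul_le_mul_of_nonneg_right h8 (abs_nonneg _)

/-- **The truncation residual in the infinite-volume energy density**: dropping `t''` (object M → object E
of a one-band box) moves the translation-invariant ground-state energy density by at most `8|t''|`:
`|e₀(t, t', t'', U) − e₀(t, t', U)| ≤ 8|t''|` (range parameter `2` on both sides). [cite: Israel1979, Thm. I.3.4] -/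
theorem abs_tiGroundEnergyDensity_tpp_sub_ttPrime_le :
    |(hubbardTT'T''FermionInteraction t t' t'' U).tiGroundEnergyDensity 2 -
        (hubbardTTPrimeFermionInteraction t t' U).tiGroundEnergyDensity 2| ≤ 8 * |t''| := by
  have h := abs_tiGroundEnergyDensity_tpp_sub_le_eight_mul t t' t'' U 0
  rwa [hubbardTT'T''FermionInteraction_zero, sub_zero] at h

end TTPrimeTPP

end Literature.MathematicalPhysics.QuantumLattice

end
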